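import Summits.QuantumFields.BalabanUV.Beta.RemainderExplicitRoad
import Literature.MathematicalPhysics.QuantumFieldTheory.Balaban1983to89.Beta.RemainderWitness

/-!
# Beta / RemainderExplicitWitness — BINDER-OWNERS row D4, ROAD P3 (co-owner #3, unit `b2b-balaban-beta-d4-p3`):
# JOINT NON-VACUITY of the hypothesis list of the road's END `RemainderExplicitRoad.ResidualChain.abs_beta1_le`

HONEST FRAMING (page 1 of everything the β sub-cell writes): discharging `BetaPertH` makes Bałaban's UV stability
UNCONDITIONAL — a real constructive-QFT result; it is NOT the continuum limit and NOT the Clay problem.  HONEST DEPENDENCY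
(verbatim): «continuum YM on T⁴ ⇐ BetaPertH ∧ nine spine estimates (0/9 proved); BetaPertH ⇐ (D1) ∧ (D4) ∧ CAP+tail;
G-an2-4 gates asym, D1 and NE2/3/4.»  THIS MODULE IS `[folklore]`: an explicit, closed-term inhabitant of EVERY binder of the
road's END simultaneously — the explicit carrier (zero test configurations on `ℂ`), its decay (E) and volume limit (V), the
residual (R) at zero activity (the row owner's `RemainderWitness.zeroStep` / `c₀` / `splitZero` BY NAME), the four numeric
conditions, the closing relation and the signs.  Value = the road's hypothesis structures are
CONSISTENT (no binder is secretly `False`), exactly as `RemainderWitness.binders_inhabited` certifies for the owner's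
carriers.  NOT Bałaban's values; NOT summit progress; nothing printed is asserted.

ABSOLUTE RULE (cell charter, verbatim): "No internally-minted statement may enter as a cited fact. Every hypothesis is
either kernel-proved in this package or a verbatim quotation of a PUBLISHED theorem with page reference. The manuscript(s)
under audit are NOT citable for their own disputed steps — they are the thing under adjudication; programme-internal
(2001/route/tribunal) claims are never citable."
-/

namespace Summit.QuantumFields.BalabanUV.Beta.RemainderExplicitWitness

open Literature.MathematicalPhysics.QuantumFieldTheory.Balaban1983to89
open Literature.MathematicalPhysics.QuantumFieldTheory.Balaban1983to89.Beta
open FlowStep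
open Beta.RemainderChain (RemainderConst)
open Beta.RemainderChainLattice (CondsL SignsL remCoeffL)
open Beta.RemainderLimitTorus (LDom)
open Beta.RemainderWitness (c₀ splitZero zeroStep zeroStep_spRestr zeroStep_repr213 zeroStep_bound238With mixedDeriv_zero
  c₀_condsL c₀_R22gen c₀_signsL c₀_activity_pos)
open Summit.QuantumFields.BalabanUV.Beta.RemainderExplicitRoad
open Filter Topology

noncomputable section

variable {d : ℕ}

/-! ## §1 The zero explicit carrier and its (E), (V) -/

/-- **THE ZERO CARRIER**: exhausting tori `N n = n + 1`, test-vector spaces `ℂ`, ALL test configurations `0`,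
restricted-configuration spaces `ℂ`, restrictions `0`, limits `0`.  A closed term. [folklore] -/
def zeroCarrier (d M : ℕ) [NeZero M] : ExplicitCarrier d M where
  N := fun n => n + 1
  hNlim := tendsto_add_atTop_nat 1
  Wn := fun _ => ℂ
  tc := fun _ _ _ => 0
  V := fun _ => ℂ
  r := fun _ _ => 0
  t := fun _ _ => 0

/-- (E) for the zero carrier: decay with ANY `B₃ ≥ 0` and any rate. [folklore] -/
theorem zeroCarrier_decay (d M : ℕ) [NeZero M] {B₃ : ℝ} (hB : 0 ≤ B₃) (δ₀ : ℝ) : (zeroCarrier d M).Decay B₃ δ₀ := by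
  intro n X x
  show ‖(0 : ℂ)‖ ≤ _
  rw [norm_zero]
  positivity

/-- (V) for the zero carrier: `0 → 0`. [folklore] -/
theorem zeroCarrier_limit (d M : ℕ) [NeZero M] : (zeroCarrier d M).Limit := by
  intro Y x
  show Tendsto (fun _ : ℕ => ((0 : ℂ →L[ℂ] ℂ) (0 : ℂ))) atTop (𝓝 (0 : ℂ))
  simpa using tendsto_const_nhds

/-! ## §2 The residual (R) at zero activity, relative to the zero carrier -/

/-- **THE ZERO RESIDUAL** relative to the zero carrier, with infinite-volume terms `0`, for ANY constants with
`0 ≤ C₃ε₁`: the row owner's zero-activity torus steps (`RemainderWitness.zeroStep`: every activity 0, so Lemma 3's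
(2.38)_ℓ, the restriction property and (2.13) hold trivially), `EXn = 0`, `F = 0`.  A closed term. [folklore] -/
def zeroResidual (d M : ℕ) [NeZero M] (c : B13.Consts) (ℓ α₂ : ℝ) (hA : 0 ≤ c.C3act * c.ε₁) :
    Residual (zeroCarrier d M) (fun (_ : LDom d) (_ : B13ScaleTransfer.Pt d) => (0 : ℝ)) c ℓ α₂ where
  W := fun n => zeroStep d (n + 1)
  hsp := fun n => zeroStep_spRestr d (n + 1)
  hrep := fun n => zeroStep_repr213 d (n + 1)
  h238 := fun n => zeroStep_bound238With d (n + 1) c ℓ hA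
  EXn := fun _ _ _ => 0
  emb := fun _ _ _ => ()
  hemb := fun _ _ _ _ => Set.mem_univ _
  hcomp := fun _ _ _ => rfl
  E2n := fun _ _ _ _ => 0
  han := fun _ _ => analyticOnNhd_const
  hrepr := fun _ _ _ _ => by rw [mixedDeriv_zero]; simp
  F := fun _ _ => 0
  hF := fun _ => analyticAt_const
  hfac := fun _ => Eventually.of_forall fun _ _ _ => by simp
  ha := fun _ _ => by rw [mixedDeriv_zero]; simp

/-- **THE ZERO RESIDUAL CHAIN** for the split `splitZero` (`β ≡ 1 = 1 + 0`): `A1 ≡ 0`, so `limKernel 0 = 0` and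
`β¹ ≡ 0` is its second moment. [folklore] -/
def zeroResidualChain (d M : ℕ) [NeZero M] (μ ν : Fin d) (γ : ℝ) (c : B13.Consts) (ℓ α₂ : ℝ)
    (hA : 0 ≤ c.C3act * c.ε₁) :
    ResidualChain d M μ ν splitZero γ c ℓ α₂ (fun _ => zeroCarrier d M) where
  A1 := fun _ _ _ _ => 0
  beta1_eq := fun _ _ _ => by
    show (0 : ℝ) = B12Beta.secondMoment
      (fun _ _ => RemainderLimitTorus.limKernel (fun (_ : LDom d) (_ : B13ScaleTransfer.Pt d) => (0 : ℝ))) μ ν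
    simp [B12Beta.secondMoment, RemainderLimitTorus.limKernel]
  res := fun _ _ _ => zeroResidual d M c ℓ α₂ hA

/-! ## §3 Every binder of the road's END inhabited simultaneously, and the END applied -/

/-- **JOINT NON-VACUITY OF ROAD P3's END** (d, M ≥ 1 arbitrary, any μ, ν, γ): a residual chain (R) over a family of
explicit carriers, the carriers' k-uniform decay (E) with `B₃ = 1` at the chain's rate `c.δ₀`, their volume limit (V), and
the numeric side `CondsL ∧ R22gen ∧ SignsL` — all at once, at the owner's witness constants `c₀ d`, `ℓ = 2`, `α₂ = 1`.
[folklore] -/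
theorem road_binders_inhabited (d M : ℕ) [NeZero M] (μ ν : Fin d) (γ : ℝ) :
    Nonempty (ResidualChain d M μ ν splitZero γ (c₀ d) 2 1 (fun _ => zeroCarrier d M)) ∧
      (∀ k : ℕ, ((fun _ => zeroCarrier d M) k).Decay 1 (c₀ d).δ₀) ∧
      (∀ k : ℕ, ((fun _ => zeroCarrier d M) k).Limit) ∧
      CondsL d (c₀ d) 2 ∧ (c₀ d).R22gen 2 ∧ SignsL (c₀ d) 1 1 :=
  ⟨⟨zeroResidualChain d M μ ν γ (c₀ d) 2 1 (c₀_activity_pos d).le⟩, fun _ => zeroCarrier_decay d M zero_le_one _,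
    fun _ => zeroCarrier_limit d M, c₀_condsL d, c₀_R22gen d, c₀_signsL d⟩

/- The END applied to this witness (`(zeroResidualChain …).abs_beta1_le …`) has LITERALLY the conclusion of the owner's
`RemainderWitness.endT_applied` (`RemainderConst splitZero γ (ε₁(c₀ d) · remCoeffL d M (c₀ d) 1 1)`), already in the tree —
not restated here (gate `dedup.landed`); `road_binders_inhabited` is the non-vacuity certificate of road P3. -/

end

end Summit.QuantumFields.BalabanUV.Beta.RemainderExplicitWitness
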